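import Literature.Barriers.AtomisticToContinuum.KissingTwelveDegeneracy
import Literature.MathematicalPhysics.StatisticalMechanics.BarlowRings
import Literature.Geometry.DiscreteGeometry.KissingPatterns

/-!
# `CleanLimitsHaveWindows` (stmt-AtomisticToContinuum-15932), negative side I:
# ideal stackings are clean

Route `GappedShellCensus`, crux `CleanLimitsHaveWindows` (rank 5).  Support file 1/4 of the
load-bearing analysis `cleanLimitsHaveWindows_false_without_groundState` (file
`FalseWithoutGroundState.lean`) by the standing disprover
(refuter-cdisprove-stmt-AtomisticToContinuum-15932-0): the hypothesis
`∀ N, IsGroundState lennardJones (x N)` of the crux is LOAD-BEARING — with it replaced by mere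
injectivity the statement is false, the witness being an aperiodically stacked close packing.

This file verifies the crux's CLEANNESS clause (hypothesis H5, verbatim with `a = 1`) for the unit
ideal Barlow stacking `barlowStacking 1 √(2/3) s` of an ARBITRARY Hägg sequence `s`:

* `dist_dichotomy` — two distinct points of the stacking are at distance exactly `1` or `≥ √2`
  (the distance gap of `BarlowRings.lean`, `eq_or_dist_eq_of_dist_lt`): gapped twelve at
  tolerance `0`;
* `radial_clean` — exactly twelve bonds in `[0.98, 1.02]`, hard core, empty annulus `(1.02, 1.26)`
  (tree: `ncard_touching_eq_twelve`);
* `shell_clean` — the recentred bond shell is, after a linear isometry, EXACTLY the fcc or the hcp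
  kissing pattern (tree: `HalesDSP_stackingShells_holds`, Hales DSP §1.3, rescaled from Hales's
  spacing `2` by `barlowPos_two`), hence `ShellCloseTo (1/5)` it;
* `clean` — the conjunction, in the syntactic shape of the crux.

No definitions, no notation. All `[folklore]`.
-/

noncomputable section

namespace Summit.AtomisticToContinuum.Crystallization.Theorems.CleanLimitsHaveWindows.Negative

open Literature.MathematicalPhysics.StatisticalMechanics Literature.Geometry.DiscreteGeometry

variable {s : ℤ → ℤ}

/-- **Distance dichotomy**: two distinct points of `barlowStacking 1 √(2/3) s` are at distance `1`
or `≥ √2`; in particular the stacking is gapped-twelve at tolerance `0`. [folklore] -/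
theorem dist_dichotomy (hs : IsHaggSeq s) {p q : (EuclideanSpace ℝ (Fin 3))} (hp : p ∈ barlowStacking 1 (Real.sqrt (2 / 3)) s)
    (hq : q ∈ barlowStacking 1 (Real.sqrt (2 / 3)) s) (hpq : p ≠ q) :
    dist p q = 1 ∨ Real.sqrt 2 ≤ dist p q := by
  by_cases hlt : dist p q < Real.sqrt 2 * 1
  · exact Or.inl ((eq_or_dist_eq_of_dist_lt hs one_pos (by rw [Real.sq_sqrt (by norm_num)]; ring) hp hq hlt).resolve_left hpq)
  · right; linarith

/-- The `1.02`-bond set of a site is its touching set. [folklore] -/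
theorem bondSet_eq (hs : IsHaggSeq s) {y : (EuclideanSpace ℝ (Fin 3))} (hy : y ∈ barlowStacking 1 (Real.sqrt (2 / 3)) s) :
    {w ∈ barlowStacking 1 (Real.sqrt (2 / 3)) s | w ≠ y ∧ dist y w ≤ 1 * (1 + 1 / 50)} =
      {w | w ∈ barlowStacking 1 (Real.sqrt (2 / 3)) s ∧ dist y w = 1} := by
  ext w
  simp only [Set.mem_setOf_eq]
  constructor
  · rintro ⟨hw, hne, hle⟩
    refine ⟨hw, ?_⟩
    rcases dist_dichotomy hs hy hw (Ne.symm hne) with h | h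
    · exact h
    · exfalso
      have hs2 : (1.41 : ℝ) < Real.sqrt 2 := by rw [Real.lt_sqrt (by norm_num)]; norm_num
      linarith
  · rintro ⟨hw, h1⟩
    refine ⟨hw, ?_, by rw [h1]; norm_num⟩
    rintro rfl
    rw [dist_self] at h1
    exact zero_ne_one h1

/-- **Gapped-twelve, radial part** (the crux's radial clause at `a = 1`): exactly twelve bonds,
hard core `0.98`, empty annulus `(1.02, 1.26)`. [folklore] -/
theorem radial_clean (hs : IsHaggSeq s) {y : (EuclideanSpace ℝ (Fin 3))} (hy : y ∈ barlowStacking 1 (Real.sqrt (2 / 3)) s) :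
    {w ∈ barlowStacking 1 (Real.sqrt (2 / 3)) s | w ≠ y ∧ dist y w ≤ 1 * (1 + 1 / 50)}.ncard = 12 ∧
      ∀ w ∈ barlowStacking 1 (Real.sqrt (2 / 3)) s, w ≠ y → 1 * (1 - 1 / 50) ≤ dist y w ∧
        (dist y w ≤ 1 * (1 + 1 / 50) ∨ 1 * (63 / 50) ≤ dist y w) := by
  refine ⟨?_, fun w hw hne => ?_⟩
  · rw [bondSet_eq hs hy]
    exact ncard_touching_eq_twelve hs one_pos (by rw [Real.sq_sqrt (by norm_num)]; ring) hy
  · have hs2 : (1.41 : ℝ) < Real.sqrt 2 := by rw [Real.lt_sqrt (by norm_num)]; norm_num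
    rcases dist_dichotomy hs hy hw (Ne.symm hne) with h | h
    · rw [h]; norm_num
    · constructor
      · linarith
      · right; linarith

/-! ### Shell shapes: rescaling Hales's stacking -/

/-- Hales's stacking (spacing `2`) is twice the unit stacking, pointwise. [folklore] -/
theorem barlowPos_two (s : ℤ → ℤ) (k i j : ℤ) :
    barlowPos 2 (2 * Real.sqrt (2 / 3)) s k i j = (2 : ℝ) • barlowPos 1 (Real.sqrt (2 / 3)) s k i j := by
  ext l
  fin_cases l <;> simp <;> ring

/-- Membership in Hales's stacking is membership of the half point in the unit one. [folklore] -/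
theorem mem_hales_iff {v : (EuclideanSpace ℝ (Fin 3))} :
    v ∈ barlowStacking 2 (2 * Real.sqrt (2 / 3)) s ↔
      (1 / 2 : ℝ) • v ∈ barlowStacking 1 (Real.sqrt (2 / 3)) s := by
  constructor
  · rintro ⟨k, i, j, rfl⟩
    refine ⟨k, i, j, ?_⟩
    rw [barlowPos_two, smul_smul]; norm_num
  · rintro ⟨k, i, j, h⟩
    refine ⟨k, i, j, ?_⟩
    rw [barlowPos_two, ← h, smul_smul]; norm_num

/-- **Shell shapes** (the crux's shape clause at `a = 1`): the recentred bond shell of every site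
is, after a linear isometry, exactly the fcc or the hcp kissing pattern (Hales, DSP §1.3; tree
theorem `HalesDSP_stackingShells_holds`), hence `1/5`-close to it. [folklore] -/
theorem shell_clean (hs : IsHaggSeq s) {y : (EuclideanSpace ℝ (Fin 3))} (hy : y ∈ barlowStacking 1 (Real.sqrt (2 / 3)) s) :
    ∃ T : Finset (EuclideanSpace ℝ (Fin 3)), (↑T : Set (EuclideanSpace ℝ (Fin 3))) =
        (fun w => (1 : ℝ)⁻¹ • (w - y)) ''
          {w ∈ barlowStacking 1 (Real.sqrt (2 / 3)) s | w ≠ y ∧ dist y w ≤ 1 * (1 + 1 / 50)} ∧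
      (ShellCloseTo (1 / 5) T fccKissingPattern ∨ ShellCloseTo (1 / 5) T hcpKissingPattern) := by
  classical
  have hy2 : (2 : ℝ) • y ∈ barlowStacking 2 (2 * Real.sqrt (2 / 3)) s := by
    rw [mem_hales_iff, smul_smul, show (1 / 2 : ℝ) * 2 = 1 by norm_num, one_smul]; exact hy
  have hshell := Literature.Barriers.AtomisticToContinuum.HalesDSP_stackingShells_holds s hs _ hy2
  -- the recentred unit shell is `A '' pattern`
  have key : ∀ (P : Finset (EuclideanSpace ℝ (Fin 3))) (A : (EuclideanSpace ℝ (Fin 3)) →ₗᵢ[ℝ] (EuclideanSpace ℝ (Fin 3))),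
      kissingShell (barlowStacking 2 (2 * Real.sqrt (2 / 3)) s) ((2 : ℝ) • y) =
        (fun p => (2 : ℝ) • A p) '' (P : Set (EuclideanSpace ℝ (Fin 3))) →
      (↑(P.image A) : Set (EuclideanSpace ℝ (Fin 3))) =
        (fun w => (1 : ℝ)⁻¹ • (w - y)) ''
          {w ∈ barlowStacking 1 (Real.sqrt (2 / 3)) s | w ≠ y ∧ dist y w ≤ 1 * (1 + 1 / 50)} := by
    intro P A hA
    rw [bondSet_eq hs hy, Finset.coe_image]
    ext x
    simp only [Set.mem_image, Finset.mem_coe, Set.mem_setOf_eq, inv_one, one_smul]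
    constructor
    · rintro ⟨p, hp, rfl⟩
      have hmem : (2 : ℝ) • A p ∈ kissingShell (barlowStacking 2 (2 * Real.sqrt (2 / 3)) s)
          ((2 : ℝ) • y) := by rw [hA]; exact ⟨p, hp, rfl⟩
      rw [mem_kissingShell_iff] at hmem
      obtain ⟨hin, hnorm⟩ := hmem
      refine ⟨y + A p, ⟨?_, ?_⟩, by abel⟩
      · rw [← smul_add, mem_hales_iff, smul_smul, show (1 / 2 : ℝ) * 2 = 1 by norm_num,
          one_smul] at hin
        exact hin
      · rw [dist_eq_norm, sub_add_cancel_left, norm_neg]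
        rw [norm_smul, Real.norm_eq_abs, abs_of_pos two_pos] at hnorm
        linarith
    · rintro ⟨w, ⟨hw, hd⟩, rfl⟩
      have hmem : (2 : ℝ) • (w - y) ∈
          kissingShell (barlowStacking 2 (2 * Real.sqrt (2 / 3)) s) ((2 : ℝ) • y) := by
        rw [mem_kissingShell_iff]
        constructor
        · rw [← smul_add, add_sub_cancel, mem_hales_iff, smul_smul,
            show (1 / 2 : ℝ) * 2 = 1 by norm_num, one_smul]
          exact hw
        · rw [norm_smul, Real.norm_eq_abs, abs_of_pos two_pos, ← dist_eq_norm, dist_comm, hd]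
          norm_num
      rw [hA] at hmem
      obtain ⟨p, hp, hpeq⟩ := hmem
      refine ⟨p, hp, ?_⟩
      have := congrArg (fun v : (EuclideanSpace ℝ (Fin 3)) => (1 / 2 : ℝ) • v) hpeq
      simp only [smul_smul] at this
      norm_num at this
      exact this
  rcases hshell with ⟨A, hA⟩ | ⟨A, hA⟩
  · refine ⟨fccKissingPattern.image A, key _ A hA, Or.inl ⟨A, ?_⟩⟩
    exact EtaMatched.refl (by norm_num) _
  · refine ⟨hcpKissingPattern.image A, key _ A hA, Or.inr ⟨A, ?_⟩⟩
    exact EtaMatched.refl (by norm_num) _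

/-- **The unit ideal stacking of any Hägg sequence is everywhere clean at scale `1`** (the crux's
hypothesis on `Y`, verbatim with `a = 1`). [folklore] -/
theorem clean (hs : IsHaggSeq s) :
    ∀ y ∈ barlowStacking 1 (Real.sqrt (2 / 3)) s,
      ({w ∈ barlowStacking 1 (Real.sqrt (2 / 3)) s | w ≠ y ∧ dist y w ≤ 1 * (1 + 1 / 50)}.ncard = 12 ∧
      ∀ w ∈ barlowStacking 1 (Real.sqrt (2 / 3)) s, w ≠ y → 1 * (1 - 1 / 50) ≤ dist y w ∧
        (dist y w ≤ 1 * (1 + 1 / 50) ∨ 1 * (63 / 50) ≤ dist y w)) ∧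
      ∃ T : Finset (EuclideanSpace ℝ (Fin 3)), (↑T : Set (EuclideanSpace ℝ (Fin 3))) =
          (fun w => (1 : ℝ)⁻¹ • (w - y)) ''
          {w ∈ barlowStacking 1 (Real.sqrt (2 / 3)) s | w ≠ y ∧ dist y w ≤ 1 * (1 + 1 / 50)} ∧
        (ShellCloseTo (1 / 5) T fccKissingPattern ∨ ShellCloseTo (1 / 5) T hcpKissingPattern) :=
  fun _ hy => ⟨radial_clean hs hy, shell_clean hs hy⟩

end Summit.AtomisticToContinuum.Crystallization.Theorems.CleanLimitsHaveWindows.Negative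

end
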